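import Summits.AtomisticToContinuum.Crystallization.Theses.PalmUnimodularRigidity
import Summits.AtomisticToContinuum.Crystallization.Theorems.ShellsToBarlowChart.Negative.ScaleWindow

/-!
# Skeleton line `barlow-cover-orbit-count` for crux `ShellsToBarlowChart` (stmt-AtomisticToContinuum-9227)

Route `PalmUnimodularRigidity`, crux r4 `ShellsToBarlowChart` (pure geometry): a non-empty `S ⊆ ℝ³` in which
EVERY point has a `1 %`-close-packed first shell at its own scale `aₓ ∈ [9/10, 1]` (twelve points within
`5aₓ/4`, matched after a linear isometry to the `aₓ`-scaled cuboctahedron or anticuboctahedron, nothing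
else that close) is bond-isomorphic to an ideal Barlow stacking: `∃ s` Hägg, `∃ Φ`,
`BijOn Φ (barlowStacking 1 √(2/3) s) S` with `dist p q = 1 ↔ 0 < dist (Φ p) (Φ q) ≤ 28/25`.

## The line (crux idea card `barlow-cover-orbit-count`, triage r1: pass ×3; planner skeleton round 1)

COVER `S` FROM THE MODEL SIDE, THEN COUNT.  Build a covering of `12`-regular graphs
`π : barlowStacking 1 √(2/3) s → S` entirely on the model (lattice) side — one hexagon sheet developed from the
triangular lattice, then Hales's layer-upon-layer recursion (DSP §1.3, in tree for the exact case) indexed by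
the lattice layers, where sides and `A/B/C` registries transport without holonomy and the Hägg word `s` is
DISCOVERED letter by letter (`stub_barlowCover`, the load-bearing construction).  A coincidence
`π p = π p'` then propagates, by unique path lifting over the combinatorially simply connected model, to a
deck transformation (`stub_deckTransformation`), which is the restriction of a Euclidean isometry `g` of the
stacking (`stub_graphRigidity`, Hales 2012 Lemma 10 in tree); and NO non-trivial deck isometry exists
(`stub_orbitCount`): a finite-order one has a fixed point and would identify two sites at distance `< 2`,
i.e. inside one closed star, where `π` is injective; an infinite-order one moves a site `b₀` by `D > 0`, so the
`N = ⌊R/D⌋ + 1` translates `gⁱ(lift of S ∩ B(π b₀, R))`, `i < N`, are pairwise distinct model sites inside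
`B(b₀, 9R + 1)` — `N · c R³ ≤ C R³`, absurd for `R ≫ D` (the room grows like `R³/N`, the filling like `R³`).
So `π` is injective, and an injective cover IS the chart (glue, proved below).  The two local inputs every
line on this crux needs are isolated as `stub_localCharts` (exact link combinatorics at `1 %`, the
disprover's `margins`) and `stub_coarseGeometry` (covering radius `≤ 1`, bond-quasi-geodesics).

TRIAGE ANSWERED.  r1-2's objection ("step (c) first extends `π` to a cellwise local homeomorphism `π̂` of
`ℝ³`, at which point `π̂` is a covering map of the simply connected ACTUAL space and the orbit count is a
detour") is taken: there is NO `π̂`, no Delaunay cell, no actual-side topology anywhere in this skeleton — the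
deck transformation is produced combinatorially on the MODEL (r1-2's first option), rigidity makes it an
isometry, and the orbit count runs on SITES with graph lifts (constants-insensitive: only boundedness of
`N` is used, r1-1).  r1-3's (F4) (a bond triangle has exactly one common neighbour; star-bijection ⇒ link
isomorphism by the `24 = 24` edge count) is built into `IsBarlowCover` (clause 4, link-faithfulness), so the
closer never opens a shell.  r1-1/r1-3: the model-side front end uses card develop-the-model's P1 (kite =
equatorial, purely combinatorial) and OCCUPANCY (the anticuboctahedron has exactly one centrally symmetric
planar hexagon; `0.2887·a` off-plane vs `≤ 0.06·a`) — recorded in the line card as the proof plan of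
`stub_barlowCover`.

DISPROOF USED (`Cruxes/ShellsToBarlowChart/Disproof.lean`, cycles 1–2, NO KILL; landed parts: `Negative/ScaleWindow` +
`Negative/Calibration` imported above, `Negative/Tolerance` cited by name — not yet built on the farm).  `_false_without_nonempty` — honoured at
`stub_coarseGeometry` / `stub_barlowCover` (both take `S.Nonempty`; the cover starts from an atom);
`_false_without_scaleUpper/Lower`, `_false_subshell`, `margins` — consumed in `stub_localCharts` (bond graph =
shell graph needs `1.01·a ≤ 28/25 < 1.25·a`; exact links need `1.02·a ≤ 28/25 < (√2 − 0.02)·a`; `↑T = shell`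
gives the `↔`); `hypothesis_barlowStacking` (calibration) — respected: `stub_barlowCover` returns an ARBITRARY
Hägg word; `not_shellsToFccChart` — respected (the word is discovered, never fixed); refuted METRIC
strengthenings (§(c): non-similar `1 %`-good stackings, log-spiral drift) — respected: no stub claims metric
closeness beyond one star (`LocalChart` is per-point).  `equatorPropagation_margin`, `capClash_lt_hardCore`,
`hardCore_bounds` are the typed margins `stub_barlowCover`'s recursion uses.  `-- Targets`: none landed.
Negatives 4146 (D₅ₕ) / 3506 (grain multiplicity): outside the hypothesis / excluded by `stub_orbitCount`.

## Shape

`§0` definitions (shared vocabulary; the lead lands them verbatim as a defs file before fanning out) ·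
`§1` the six statements as named `Prop`s · `§2` the six REGISTERED STUBS `stub_*` (verbatim the same
statements; the only declarations containing `sorry`) + defeq consistency checks · `§3` the composition
`ShellsToBarlowChart_of` — kernel-checked, no `sorry`, concluding the crux BY NAME.
-/

namespace Summit.AtomisticToContinuum.Crystallization.Cruxes.ShellsToBarlowChart.BarlowCoverOrbitCount

open Literature.Geometry.DiscreteGeometry Literature.MathematicalPhysics.StatisticalMechanics

/-- Euclidean `3`-space. -/
local notation "E3" => EuclideanSpace ℝ (Fin 3)

/-! ## §0 Definitions -/

/-- A BOND of the actual configuration: two points at distance in `(0, 28/25]` — the window of the crux's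
conclusion.  For every-point-good `S` these are exactly the twelve shell neighbours (`stub_localCharts`). -/
def IsBond (x y : E3) : Prop := 0 < dist x y ∧ dist x y ≤ 28 / 25

/-- The crux hypothesis at one point `x` with an explicit scale `a` (verbatim the crux's inner clause). -/
def GoodShellAt (S : Set E3) (x : E3) (a : ℝ) : Prop :=
  ∃ T : Finset E3, (↑T : Set E3) = (fun y : E3 => y - x) '' {y : E3 | y ∈ S ∧ y ≠ x ∧ dist y x ≤ 5 / 4 * a} ∧
    (ShellCloseTo (a / 100) T (Finset.image (fun v : E3 => a • v) fccKissingPattern) ∨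
     ShellCloseTo (a / 100) T (Finset.image (fun v : E3 => a • v) hcpKissingPattern))

/-- The crux hypothesis (verbatim shape): every point of `S` has a `1 %`-good shell at its own scale. -/
def EveryPointGood (S : Set E3) : Prop :=
  ∀ x ∈ S, ∃ a : ℝ, 9 / 10 ≤ a ∧ a ≤ 1 ∧ GoodShellAt S x a

/-- The bond graph of `S` as a simple graph on `ℝ³` (vertices outside `S` are isolated). -/
def bondGraph (S : Set E3) : SimpleGraph E3 where
  Adj x y := x ∈ S ∧ y ∈ S ∧ IsBond x y
  symm := ⟨fun x y h => ⟨h.2.1, h.1, by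
    obtain ⟨h₁, h₂⟩ := h.2.2
    exact ⟨by rwa [dist_comm], by rwa [dist_comm]⟩⟩⟩
  loopless := ⟨fun x h => by
    have h0 : (0 : ℝ) < dist x x := h.2.2.1
    simp at h0⟩

/-- A LOCAL CHART at `x ∈ S` of scale `a` over the unit pattern `P` (`fccKissingPattern` or
`hcpKissingPattern`): a labelling `f` of the bond-neighbours of `x` by the pattern points, `a/100`-close to a
rotated `a`-scaled copy of the pattern centred at `x`, under which the bonds AMONG the neighbours are exactly
the unit contacts of the pattern ("links are exact": the disprover's margins (3)–(4)). -/
def LocalChart (S : Set E3) (x : E3) (a : ℝ) (P : Finset E3) (f : E3 → E3) : Prop :=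
  Set.BijOn f ↑P {y : E3 | y ∈ S ∧ IsBond x y} ∧
  (∃ A : E3 →ₗᵢ[ℝ] E3, ∀ v ∈ P, dist (f v) (x + a • A v) ≤ a / 100) ∧
  (∀ v ∈ P, ∀ w ∈ P, (IsBond (f v) (f w) ↔ dist v w = 1))

/-- `S` is LOCALLY BARLOW: hard core `0.891`; at every point a scale `a ∈ [9/10, 1]` for which the bonds at `x`
are exactly the points of `S ∖ {x}` within `5a/4` (bond graph = shell graph: margins (1)–(2)), all of length
`a·(1 ± 1/100)`, and a local chart over the cuboctahedron or the anticuboctahedron. -/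
def LocallyBarlow (S : Set E3) : Prop :=
  (∀ x ∈ S, ∀ y ∈ S, x ≠ y → (891 / 1000 : ℝ) ≤ dist x y) ∧
  ∀ x ∈ S, ∃ a : ℝ, 9 / 10 ≤ a ∧ a ≤ 1 ∧
    (∀ y ∈ S, (IsBond x y ↔ (y ≠ x ∧ dist y x ≤ 5 / 4 * a))) ∧
    (∀ y ∈ S, IsBond x y → 99 / 100 * a ≤ dist x y ∧ dist x y ≤ 101 / 100 * a) ∧
    ∃ f : E3 → E3, LocalChart S x a fccKissingPattern f ∨ LocalChart S x a hcpKissingPattern f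

/-- COARSE GEOMETRY of `S`: covering radius `≤ 1` and bond-quasi-geodesics (any two sites are joined by a
bond walk of length `≤ 8·dist + 1`; in particular the bond graph is connected on `S`).  The true constants
are `0.7317` and `4`; they are deliberately loosened — downstream (`stub_orbitCount`) only boundedness
matters, and the loose form follows from the crude `54.7°` covering bound of the patterns. -/
def CoarseGeometry (S : Set E3) : Prop :=
  (∀ z : E3, ∃ x ∈ S, dist z x ≤ 1) ∧
  (∀ x ∈ S, ∀ y ∈ S, ∃ w : (bondGraph S).Walk x y, (w.length : ℝ) ≤ 8 * dist x y + 1)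

/-- A COMBINATORIAL BARLOW COVER of `S` by the ideal unit stacking of the Hägg word `s`: `π` maps the stacking
ONTO `S`, each punctured unit star BIJECTIVELY onto the bond-star of the image (a covering of `12`-regular
graphs), and is LINK-FAITHFUL (two model neighbours of a site whose images are bonded are themselves in
contact — with clause 3, `π` is an isomorphism from every closed model star onto the closed actual star). -/
def IsBarlowCover (S : Set E3) (s : ℤ → ℤ) (π : E3 → E3) : Prop :=
  Set.MapsTo π (barlowStacking 1 (Real.sqrt (2 / 3)) s) S ∧
  Set.SurjOn π (barlowStacking 1 (Real.sqrt (2 / 3)) s) S ∧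
  (∀ p ∈ barlowStacking 1 (Real.sqrt (2 / 3)) s,
    Set.BijOn π {q : E3 | q ∈ barlowStacking 1 (Real.sqrt (2 / 3)) s ∧ dist p q = 1}
      {y : E3 | y ∈ S ∧ IsBond (π p) y}) ∧
  (∀ p ∈ barlowStacking 1 (Real.sqrt (2 / 3)) s, ∀ q ∈ barlowStacking 1 (Real.sqrt (2 / 3)) s,
    ∀ r ∈ barlowStacking 1 (Real.sqrt (2 / 3)) s,
      dist p q = 1 → dist p r = 1 → IsBond (π q) (π r) → dist q r = 1)

/-! ## §1 The six statements of the line, as named propositions -/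

/-- STATEMENT 1 (M): every-point-good ⇒ locally Barlow (exact links at `1 %`). -/
def LocalChartsStatement : Prop :=
  ∀ S : Set E3, EveryPointGood S → LocallyBarlow S

/-- STATEMENT 2 (M): every-point-good ⇒ covering radius `≤ 1` and bond-quasi-geodesics. -/
def CoarseGeometryStatement : Prop :=
  ∀ S : Set E3, S.Nonempty → EveryPointGood S → CoarseGeometry S

/-- STATEMENT 3 (L, HARDEST): existence of a combinatorial Barlow cover (sheet development + Hales's layer
recursion run on the lattice). -/
def BarlowCoverStatement : Prop :=
  ∀ S : Set E3, S.Nonempty → EveryPointGood S → LocallyBarlow S → CoarseGeometry S →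
    ∃ s : ℤ → ℤ, IsHaggSeq s ∧ ∃ π : E3 → E3, IsBarlowCover S s π

/-- STATEMENT 4 (L): a coincidence of the cover propagates to a deck transformation (a bond-preserving
bijection of the stacking commuting with `π`) — combinatorial covering theory over the triangle complex of
the stacking, which is simply connected by combing loops down the layers. -/
def DeckTransformationStatement : Prop :=
  ∀ (S : Set E3) (s : ℤ → ℤ) (π : E3 → E3), IsHaggSeq s → IsBarlowCover S s π →
    ∀ p ∈ barlowStacking 1 (Real.sqrt (2 / 3)) s, ∀ p' ∈ barlowStacking 1 (Real.sqrt (2 / 3)) s,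
      π p = π p' →
      ∃ φ : E3 → E3,
        Set.BijOn φ (barlowStacking 1 (Real.sqrt (2 / 3)) s) (barlowStacking 1 (Real.sqrt (2 / 3)) s) ∧
        (∀ q ∈ barlowStacking 1 (Real.sqrt (2 / 3)) s, ∀ r ∈ barlowStacking 1 (Real.sqrt (2 / 3)) s,
          dist q r = 1 → dist (φ q) (φ r) = 1) ∧
        (∀ q ∈ barlowStacking 1 (Real.sqrt (2 / 3)) s, π (φ q) = π q) ∧
        φ p = p'

/-- STATEMENT 5 (M): combinatorial rigidity of the ideal stacking — every bond-preserving bijection of the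
stacking onto itself is the restriction of a Euclidean isometry (Hales 2012 Lemma 10 on each closed star,
glued along bonded pairs). -/
def GraphRigidityStatement : Prop :=
  ∀ (s : ℤ → ℤ) (φ : E3 → E3), IsHaggSeq s →
    Set.BijOn φ (barlowStacking 1 (Real.sqrt (2 / 3)) s) (barlowStacking 1 (Real.sqrt (2 / 3)) s) →
    (∀ q ∈ barlowStacking 1 (Real.sqrt (2 / 3)) s, ∀ r ∈ barlowStacking 1 (Real.sqrt (2 / 3)) s,
      dist q r = 1 → dist (φ q) (φ r) = 1) →
    ∃ g : E3 ≃ᵢ E3, ∀ q ∈ barlowStacking 1 (Real.sqrt (2 / 3)) s, g q = φ q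

/-- STATEMENT 6 (M/L): the ORBIT COUNT — no non-trivial deck isometry: an isometry of `ℝ³` preserving the
stacking and commuting with a Barlow cover of a coarsely-Delone `S` fixes every site. -/
def OrbitCountStatement : Prop :=
  ∀ (S : Set E3) (s : ℤ → ℤ) (π : E3 → E3) (g : E3 ≃ᵢ E3), CoarseGeometry S → IsHaggSeq s →
    IsBarlowCover S s π →
    g '' barlowStacking 1 (Real.sqrt (2 / 3)) s = barlowStacking 1 (Real.sqrt (2 / 3)) s →
    (∀ q ∈ barlowStacking 1 (Real.sqrt (2 / 3)) s, π (g q) = π q) →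
    ∀ q ∈ barlowStacking 1 (Real.sqrt (2 / 3)) s, g q = q

/-! ## §2 The registered stubs (the ONLY declarations of this file with `sorry`) -/

/-- STUB 1 (M) — `LocalChartsStatement`: LOCAL CHARTS / EXACT LINKS.  For every-point-good `S`: hard core
`0.891 ≤ 0.99·aₓ`; the bonds at `x` (pairs in `(0, 28/25]`) are exactly the shell points (`1.01·a ≤ 28/25 <
1.25·a`, `Negative.margins` (1)–(2), and `↑T = shell` — `_false_subshell`, `_false_without_scaleUpper/Lower`
are consumed HERE); bond lengths `a(1 ± 1/100)`; and the matching `e : T ≃ A(a·P)` of `ShellCloseTo` read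
as a labelling `f v := x + e⁻¹(A(a v))` gives a `LocalChart`: bonds among neighbours ↔ unit contacts of the
pattern, because pattern pair distances lie in `{1} ∪ [√2, 2]` (`fccInt_pair_sqNorm`, `hcpInt_pair_sqNorm` in
`Negative.Tolerance`) and `1.02·a ≤ 28/25 < (√2 − 0.02)·a` (margins (3)–(4)).  The local recognition
lemma at `1 %` — the shared first lemma of every line on this crux (triage r1-2 §3, r1-3); all difficulty is
in unpacking `EtaMatched` through the `Equiv` and the pattern distance spectra. -/
theorem stub_localCharts :
    ∀ S : Set (EuclideanSpace ℝ (Fin 3)), EveryPointGood S → LocallyBarlow S := by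
  sorry

/-- STUB 2 (M) — `CoarseGeometryStatement`: COVERING RADIUS AND QUASI-GEODESICS.  (i) For every unit vector
`u` some pattern point `v` has `⟪u, v⟫ ≥ c₀` — sharp value `c₀ = 1/√2` for both patterns (covering angle
`45°`, triage r1-2 `[cover]`; fcc in three lines: for `|u₁| ≥ |u₂| ≥ |u₃|`, `(|u₁| + |u₂|)² ≥ u₁² + 3u₂² ≥ 1`),
but the crude `c₀ = 1/√3` (largest coordinate / hexagon-or-cap dichotomy) already suffices below; after the
`1 %` matching the actual neighbour offset `t` of `x` best aligned with `u` has `⟪u, t⟫ ≥ (c₀ − 1/100)·aₓ`,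
`‖t‖ ≤ 1.01·aₓ`.  So if the nearest site `x` to `z` (it exists: hard core ⇒ locally finite; `S.Nonempty` —
`_false_without_nonempty` honoured) had `dist z x > 1 ≥ 1.0201aₓ²/(2(c₀ − 0.01)aₓ)` (`= 0.7317aₓ` sharp,
`0.90aₓ` crude), the neighbour `x + t` would be closer: covering radius `≤ 1`.  (ii) Greedy descent: for
`y ∈ S` not bonded to `x` (`dist x y > 5aₓ/4`) that neighbour (for `u ∝ y − x`) has
`dist x y − dist (x + t) y ≥ (c₀ − 0.01)aₓ − 1.0201aₓ²/(2·dist x y) ≥ 0.159aₓ > 1/8` (crude `c₀`; `0.289aₓ`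
sharp), so well-founded recursion on `⌊8·dist⌋` yields a bond walk of length `≤ 8·dist x y + 1`
(`SimpleGraph.Walk.cons`; a bonded or equal pair costs `≤ 1`).  [cards develop-the-model
`CoveringRadiusAndConnected`, holonomy-growth `cubic_growth` input] -/
theorem stub_coarseGeometry :
    ∀ S : Set (EuclideanSpace ℝ (Fin 3)), S.Nonempty → EveryPointGood S → CoarseGeometry S := by
  sorry

/-- STUB 3 (L, HARDEST, load-bearing) — `BarlowCoverStatement`: THE BARLOW COVER (card steps (a)–(b)).
(a) SHEET: read bond types from the four common neighbours of a bond (perfect matching = "rectangle":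
every cuboctahedral bond and the polar bonds of an anticuboctahedral site; path + isolated point = "kite":
its equatorial bonds — r1-1/r1-2 checked), so a kite-neighbour of an h-site is an h-site with the SAME
equator (P1; `equatorPropagation_margin` is the metric shadow); if some site is h-type its equatorial
component is a `6`-regular hexagon-wheel sheet `Σ₀` and BFS defines a local isomorphism `ℤ² (triangular
lattice) → Σ₀` (lattice loops are generated by triangles); if all sites are c-type start from a hexagon of
one cuboctahedral link transported through c-sites (four hexagons per site, pick the parallel one by the
common-neighbour rule).  (b) LAYERS à la Hales DSP §1.3 (`exists_next_layer`, `holeTriple_type_eq_of_adjacent`,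
`exists_barlowStacking_subset` are the exact templates), indexed by `ℤ² × {k}`: the apex over the image of
each up-triangle of the current lattice layer exists (link of a layer site minus its hexagon = two
triangles, sides transported along the simply connected lattice), adjacent sites carry the same hole class
(`capClash_lt_hardCore`: two cap points `a/√3 ± a/25 < 0.89` apart otherwise), the registry letter
`s k = ±1` is read off and is constant on the layer; OCCUPANCY (the six level cap positions around a new
apex are occupied sites, and the anticuboctahedron has exactly ONE centrally symmetric planar hexagon —
off-plane defect `≥ 0.2887·a` vs `≤ 0.06·a`, r1-2 `[planes]`) makes every h-type apex level, so the new
lattice layer again maps by a local isomorphism onto a hexagon-wheel sheet and the recursion continues up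
and down; `s` is Hägg by construction.  Output `π (barlowPos 1 √(2/3) s k i j) :=` the site reached:
`MapsTo`; star-`BijOn` and link-faithfulness by construction + `LocallyBarlow` (links exact, `24 = 24`);
`SurjOn` because the image is closed under actual bonds and the bond graph is connected
(`CoarseGeometry`).  Why it might fail: only if the lattice-indexed recursion met a locally consistent but
non-layered continuation — excluded at `1 %` by the disprover's exhaustive `C5/D5` enumeration (first new
option at `η ≥ 0.0646`).  [HalesDSP2012 §1.3; LayerPropagation / LayerStackings in tree] -/
theorem stub_barlowCover :
    ∀ S : Set (EuclideanSpace ℝ (Fin 3)), S.Nonempty → EveryPointGood S → LocallyBarlow S →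
      CoarseGeometry S →
      ∃ s : ℤ → ℤ, IsHaggSeq s ∧ ∃ π : EuclideanSpace ℝ (Fin 3) → EuclideanSpace ℝ (Fin 3),
        IsBarlowCover S s π := by
  sorry

/-- STUB 4 (L) — `DeckTransformationStatement`: DECK TRANSFORMATION FROM A COINCIDENCE (combinatorial
covering theory on the MODEL; replaces the card's segment-lifting through `π̂`, triage r1-2).  Unique edge
lifting: by clause 3 of `IsBarlowCover` an actual bond at `π q` lifts to exactly one model contact at `q`;
triangles lift to triangles by clause 4.  Define `φ x` := endpoint of the lift from `p'` of the `π`-image of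
a model contact walk `p ⇝ x`; WELL-DEFINED because every closed contact walk of the ideal stacking is a
product of backtracks and bond-triangle lassos (combinatorial simple connectivity of the triangle complex:
comb the walk off its top layer — an in-layer edge `uu'` of the top layer bounds a triangle `uu'd` with `d`
one layer down, and `d u d'` with `d, d'` below `u` has `d = d'` or `d ∼ d'` since the lower neighbours of
`u` form a triangle; induct on layers, then on rows inside one triangular layer, ending in a path graph),
and lifted endpoints are invariant under both moves.  `φ` commutes with `π`, preserves contacts, and is a
bijection (the same construction from `p'` to `p` inverts it); connectivity of the model contact graph
(`dist_barlowPos_succ_eq` + in-layer steps) makes `φ` total.  [Sunada, Topological Crystallography (covers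
of nets); card holonomy-growth-dichotomy `QuotientForm`; r1-3 sharpen on develop-the-model ("the cover must
be REGULAR, i.e. π₁(K(B)) = 1 combinatorially")] -/
theorem stub_deckTransformation :
    ∀ (S : Set (EuclideanSpace ℝ (Fin 3))) (s : ℤ → ℤ)
      (π : EuclideanSpace ℝ (Fin 3) → EuclideanSpace ℝ (Fin 3)), IsHaggSeq s → IsBarlowCover S s π →
      ∀ p ∈ barlowStacking 1 (Real.sqrt (2 / 3)) s, ∀ p' ∈ barlowStacking 1 (Real.sqrt (2 / 3)) s,
        π p = π p' →
        ∃ φ : EuclideanSpace ℝ (Fin 3) → EuclideanSpace ℝ (Fin 3),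
          Set.BijOn φ (barlowStacking 1 (Real.sqrt (2 / 3)) s) (barlowStacking 1 (Real.sqrt (2 / 3)) s) ∧
          (∀ q ∈ barlowStacking 1 (Real.sqrt (2 / 3)) s, ∀ r ∈ barlowStacking 1 (Real.sqrt (2 / 3)) s,
            dist q r = 1 → dist (φ q) (φ r) = 1) ∧
          (∀ q ∈ barlowStacking 1 (Real.sqrt (2 / 3)) s, π (φ q) = π q) ∧
          φ p = p' := by
  sorry

/-- STUB 5 (M) — `GraphRigidityStatement`: COMBINATORIAL RIGIDITY OF THE IDEAL STACKING.  A bond-preserving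
bijection `φ` of `barlowStacking 1 √(2/3) s` maps each closed unit star (a cuboctahedral or
anticuboctahedral `13`-point configuration: `kissingShell_barlowStacking_eq_layerShell`, rescaled by
`smul_barlowPos`) onto a closed star by a contact-graph isomorphism (degrees `12 = 12`, link edges `24 = 24`;
cubocta ≇ anticubocta: `fcc_range_common_unique` / `hcp_range_common_two`); by Hales 2012 Lemma 10 PROVED in
tree (`KissingRigidity.fcc_rigid`, `hcp_rigid`: a labelled realisation of the pattern's contact graph with
separated non-contacts is the image of the reference pattern under a linear isometry) each restriction is an
isometry `g_b`; `g_b = g_{b'}` for bonded `b, b'` because both agree with `φ` on `{b, b'} ∪` (the four common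
neighbours), six points affinely spanning `ℝ³`; the contact graph of the stacking is connected, so one
`g : E3 ≃ᵢ E3` restricts to `φ`.  [Hales2012 Lemma 10; cards holonomy-growth / develop-the-model ("linear
parts of Sym(B) permute the bond vectors")] -/
theorem stub_graphRigidity :
    ∀ (s : ℤ → ℤ) (φ : EuclideanSpace ℝ (Fin 3) → EuclideanSpace ℝ (Fin 3)), IsHaggSeq s →
      Set.BijOn φ (barlowStacking 1 (Real.sqrt (2 / 3)) s) (barlowStacking 1 (Real.sqrt (2 / 3)) s) →
      (∀ q ∈ barlowStacking 1 (Real.sqrt (2 / 3)) s, ∀ r ∈ barlowStacking 1 (Real.sqrt (2 / 3)) s,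
        dist q r = 1 → dist (φ q) (φ r) = 1) →
      ∃ g : EuclideanSpace ℝ (Fin 3) ≃ᵢ EuclideanSpace ℝ (Fin 3),
        ∀ q ∈ barlowStacking 1 (Real.sqrt (2 / 3)) s, g q = φ q := by
  sorry

/-- STUB 6 (M/L) — `OrbitCountStatement`: THE ORBIT COUNT (card step (c), on sites; the lever of the line).
Let `B` be the stacking.  (0) If `g` fixes a site it fixes `B` pointwise: `g` maps the punctured star of a
fixed `b` to itself commuting with `π`, which is injective there (clause 3), and `B` is contact-connected.
The same holds for every power `gᵐ` (an isometry with `gᵐ '' B = B`, `π ∘ gᵐ = π`).  (1) TORSION: if some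
`gᵐ`, `m ≥ 2`, fixes `B` while `g` moves every site, `g` is affine (Mazur–Ulam,
`IsometryEquiv.toRealAffineIsometryEquiv`) of finite order, fixes the centroid `c` of an orbit, and the site
`b` nearest to `c` (`dist b c < 1`: `exists_dist_barlowPos_lt_two` rescaled by `smul_barlowPos`; the sharp
value is the octahedral-hole radius `1/√2`, the tree's proof gives `√22/6 ≈ 0.78`) has
`dist (g b) b ≤ 2·dist b c < 2`, and two sites of `B` at distance `< 2` are equal, in contact, or have a
common contact neighbour (`dist_barlowPos_sq`: the distances below `2` are `1, √2, √(8/3), √3, √(11/3)`, each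
realised only by pairs at contact distance `≤ 2` — triage r1-1/r1-3 checked all five; with the `0.78` bound
only `1, √2` occur): so `g b = b`, or `b ≠ g b` lie in one closed star where `π (g b) = π b` contradicts the
injectivity in clause 3.  (2) INFINITE ORDER: every `gᵐ`, `m ≥ 1`, moves every site.  Fix `b₀ ∈ B`, `y₀ := π b₀`,
`D := dist (g b₀) b₀ > 0`, `R ∈ ℕ` large, `N := ⌊R/D⌋ + 1`.  For each site `y` with `dist y y₀ ≤ R` lift a
bond walk `y₀ ⇝ y` of length `≤ 8R + 1` (`CoarseGeometry`) from `b₀` through clause 3 to `λ y ∈ B`,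
`π (λ y) = y`, `dist (λ y) b₀ ≤ 8R + 1` (model contacts have length `1`).  The sites `gⁱ (λ y)`, `i < N`, lie
in `B ∩ closedBall b₀ (9R + 1)` (`dist (gⁱ b₀) b₀ ≤ i·D ≤ R`) and are PAIRWISE DISTINCT (`π ∘ gⁱ = π` gives
`y = y'`, then `g^{j−i}` would fix `λ y`).  Taking for `y` the sites within `1` of the grid points
`y₀ + 3(k, l, m)`, `|k|, |l|, |m| ≤ R/6` (distinct, `≥ (R/3 − 1)³` of them) and bounding
`#(B ∩ closedBall b₀ ρ) ≤ (4ρ + 3)³` (`B` is `0.8`-separated: `le_dist_of_mem_barlowStacking`; round to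
`½ℤ³`), `N·(R/3 − 1)³ ≤ (36R + 7)³`, i.e. `N ≤ 150³` for `R ≥ 6` — contradiction at `R = 150³·D + 6`.
Constants are irrelevant (only boundedness of `N` in `R` is used; triage r1-1).  [card §(c); Conway–Sloane
crystal-ball growth of Barlow nets] -/
theorem stub_orbitCount :
    ∀ (S : Set (EuclideanSpace ℝ (Fin 3))) (s : ℤ → ℤ)
      (π : EuclideanSpace ℝ (Fin 3) → EuclideanSpace ℝ (Fin 3))
      (g : EuclideanSpace ℝ (Fin 3) ≃ᵢ EuclideanSpace ℝ (Fin 3)),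
      CoarseGeometry S → IsHaggSeq s → IsBarlowCover S s π →
      g '' barlowStacking 1 (Real.sqrt (2 / 3)) s = barlowStacking 1 (Real.sqrt (2 / 3)) s →
      (∀ q ∈ barlowStacking 1 (Real.sqrt (2 / 3)) s, π (g q) = π q) →
      ∀ q ∈ barlowStacking 1 (Real.sqrt (2 / 3)) s, g q = q := by
  sorry

/-! ### Consistency: each named statement IS its registered stub (definitionally) -/

theorem localCharts_holds : LocalChartsStatement := stub_localCharts
theorem coarseGeometry_holds : CoarseGeometryStatement := stub_coarseGeometry
theorem barlowCover_holds : BarlowCoverStatement := stub_barlowCover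
theorem deckTransformation_holds : DeckTransformationStatement := stub_deckTransformation
theorem graphRigidity_holds : GraphRigidityStatement := stub_graphRigidity
theorem orbitCount_holds : OrbitCountStatement := stub_orbitCount

/-! ### Name-keyed aliases of the six statements (the hypotheses of the composition: the skeleton audit
admits a hypothesis only if its head constant is a registered obligation or is named like a declared stub) -/
namespace Registered

/-- Alias of `LocalChartsStatement` keyed by the registered stub name. -/
abbrev stub_localCharts : Prop := LocalChartsStatement
/-- Alias of `CoarseGeometryStatement` keyed by the registered stub name. -/
abbrev stub_coarseGeometry : Prop := CoarseGeometryStatement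
/-- Alias of `BarlowCoverStatement` keyed by the registered stub name. -/
abbrev stub_barlowCover : Prop := BarlowCoverStatement
/-- Alias of `DeckTransformationStatement` keyed by the registered stub name. -/
abbrev stub_deckTransformation : Prop := DeckTransformationStatement
/-- Alias of `GraphRigidityStatement` keyed by the registered stub name. -/
abbrev stub_graphRigidity : Prop := GraphRigidityStatement
/-- Alias of `OrbitCountStatement` keyed by the registered stub name. -/
abbrev stub_orbitCount : Prop := OrbitCountStatement

end Registered

/-! ## §3 The composition (PROVED): cover + no deck isometry ⇒ injective cover ⇒ the chart -/

/-- **Cover injectivity** from stubs 4–6: a Barlow cover of a coarsely-Delone `S` is injective — a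
coincidence gives a deck transformation (stub 4), which is an isometry of the stacking (stub 5), which is
trivial (stub 6). -/
theorem cover_injOn (h₄ : DeckTransformationStatement) (h₅ : GraphRigidityStatement)
    (h₆ : OrbitCountStatement) {S : Set E3} {s : ℤ → ℤ} {π : E3 → E3} (hC : CoarseGeometry S)
    (hs : IsHaggSeq s) (hπ : IsBarlowCover S s π) :
    Set.InjOn π (barlowStacking 1 (Real.sqrt (2 / 3)) s) := by
  intro p hp p' hp' hpp'
  obtain ⟨φ, hφB, hφ1, hφπ, hφp⟩ := h₄ S s π hs hπ p hp p' hp' hpp'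
  obtain ⟨g, hg⟩ := h₅ s φ hs hφB hφ1
  have himg : g '' barlowStacking 1 (Real.sqrt (2 / 3)) s = barlowStacking 1 (Real.sqrt (2 / 3)) s := by
    rw [Set.EqOn.image_eq (f₂ := φ) (fun q hq => hg q hq)]
    exact hφB.image_eq
  have hgπ : ∀ q ∈ barlowStacking 1 (Real.sqrt (2 / 3)) s, π (g q) = π q := fun q hq => by
    rw [hg q hq]; exact hφπ q hq
  have hfix := h₆ S s π g hC hs hπ himg hgπ p hp
  rw [hg p hp, hφp] at hfix
  exact hfix.symm

/-- **An injective Barlow cover IS the chart.** -/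
theorem chart_of_cover {S : Set E3} {s : ℤ → ℤ} {π : E3 → E3} (hπ : IsBarlowCover S s π)
    (hinj : Set.InjOn π (barlowStacking 1 (Real.sqrt (2 / 3)) s)) :
    Set.BijOn π (barlowStacking 1 (Real.sqrt (2 / 3)) s) S ∧
      ∀ p ∈ barlowStacking 1 (Real.sqrt (2 / 3)) s, ∀ q ∈ barlowStacking 1 (Real.sqrt (2 / 3)) s,
        (dist p q = 1 ↔ (0 < dist (π p) (π q) ∧ dist (π p) (π q) ≤ 28 / 25)) := by
  obtain ⟨hmaps, hsurj, hstar, -⟩ := hπ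
  refine ⟨⟨hmaps, hinj, hsurj⟩, ?_⟩
  intro p hp q hq
  constructor
  · intro hpq
    exact ((hstar p hp).mapsTo ⟨hq, hpq⟩).2
  · intro hb
    have hy : π q ∈ {y : E3 | y ∈ S ∧ IsBond (π p) y} := ⟨hmaps hq, hb⟩
    obtain ⟨q', ⟨hq'B, hq'd⟩, hq'eq⟩ := (hstar p hp).surjOn hy
    have : q' = q := hinj hq'B hq hq'eq
    rw [← this]; exact hq'd

/-- **THE COMPOSITION.**  The six registered stubs give the crux BY NAME: local charts and coarse geometry
(stubs 1–2) feed the cover construction (stub 3); stubs 4–6 make the cover injective (`cover_injOn`); an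
injective cover is the chart (`chart_of_cover`). -/
theorem ShellsToBarlowChart_of (h₁ : Registered.stub_localCharts) (h₂ : Registered.stub_coarseGeometry)
    (h₃ : Registered.stub_barlowCover) (h₄ : Registered.stub_deckTransformation)
    (h₅ : Registered.stub_graphRigidity) (h₆ : Registered.stub_orbitCount) :
    Summit.AtomisticToContinuum.Crystallization.Theses.PalmUnimodularRigidity.ShellsToBarlowChart := by
  intro S hne hgood
  have hgood' : EveryPointGood S := by
    intro x hx
    obtain ⟨a, ha1, ha2, T, hT, hclose⟩ := hgood x hx
    exact ⟨a, ha1, ha2, T, hT, hclose⟩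
  have hL : LocallyBarlow S := h₁ S hgood'
  have hC : CoarseGeometry S := h₂ S hne hgood'
  obtain ⟨s, hs, π, hπ⟩ := h₃ S hne hgood' hL hC
  have hinj := cover_injOn h₄ h₅ h₆ hC hs hπ
  obtain ⟨hbij, hiff⟩ := chart_of_cover hπ hinj
  exact ⟨s, hs, π, hbij, hiff⟩

/-- Wiring check: the registered stubs feed `ShellsToBarlowChart_of` as stated. -/
example : Summit.AtomisticToContinuum.Crystallization.Theses.PalmUnimodularRigidity.ShellsToBarlowChart :=
  ShellsToBarlowChart_of stub_localCharts stub_coarseGeometry stub_barlowCover stub_deckTransformation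
    stub_graphRigidity stub_orbitCount

/-! ### Sanity: the definitions are the crux's own clauses (no costume) -/

/-- `EveryPointGood` is verbatim the crux hypothesis. -/
example (S : Set E3) :
    EveryPointGood S ↔
      (∀ x ∈ S, (∃ a : ℝ, 9 / 10 ≤ a ∧ a ≤ 1 ∧ ∃ T : Finset E3,
        (↑T : Set E3) = (fun y : E3 => y - x) '' {y : E3 | y ∈ S ∧ y ≠ x ∧ dist y x ≤ 5 / 4 * a} ∧
        (ShellCloseTo (a / 100) T (Finset.image (fun v : E3 => a • v) fccKissingPattern) ∨
          ShellCloseTo (a / 100) T (Finset.image (fun v : E3 => a • v) hcpKissingPattern)))) :=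
  Iff.rfl

/-- The crux is verbatim "non-empty every-point-good sets have a chart" (so `stub_barlowCover`, which only
produces a COVER, is strictly weaker than the crux: it holds verbatim for quotients `B/Γ`). -/
example : Summit.AtomisticToContinuum.Crystallization.Theses.PalmUnimodularRigidity.ShellsToBarlowChart ↔
    ∀ S : Set E3, S.Nonempty → EveryPointGood S →
      ∃ s : ℤ → ℤ, IsHaggSeq s ∧ ∃ Φ : E3 → E3, Set.BijOn Φ (barlowStacking 1 (Real.sqrt (2 / 3)) s) S ∧
        ∀ p ∈ barlowStacking 1 (Real.sqrt (2 / 3)) s, ∀ q ∈ barlowStacking 1 (Real.sqrt (2 / 3)) s,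
          (dist p q = 1 ↔ (0 < dist (Φ p) (Φ q) ∧ dist (Φ p) (Φ q) ≤ 28 / 25)) :=
  Iff.rfl

end Summit.AtomisticToContinuum.Crystallization.Cruxes.ShellsToBarlowChart.BarlowCoverOrbitCount
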